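import Mathlib
import Summits.NavierStokesRegularity.NavierStokesRegularity.Theorems.EulerZoomLiouvillePowerGaugeEulerLiouvilleSelfSimilarBackwardDrift
import HarnessLib.Audit

/-!
# Rung C1 of the crux `EulerZoomLiouville.PowerGaugeEulerLiouville`: BACKWARD CONFINEMENT OF A BOUNDED PROFILE NEEDS NO
# PRESSURE NORMALISATION — the `Kelvin` backward-trajectory kit without `P ≤ P₀`

Route №10 `EulerZoomLiouville` (NavierStokesRegularity), crux E = stmt-NavierStokesRegularity-19832, tenure rung C1,
registered residue `stub_selfSimilarExtremalRest`.  Lineage ns-typeII-p2 (gen 8).  Setting of the `Kelvin` files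
(ns-typeII-p3, ns-typeII-p2): `(V, P)` a self-similar Euler profile (CIV (3.3)), `V` smooth, `‖V‖ ≤ M`, `‖DV‖ ≤ K`,
`0 < γ < ½`; `W = γy + V`, `Φ` its flow, `𝒩_W = {W = 0}`.

The classical-stratum theorem `NoDrift.eq_zero_of_smooth_of_bounded` (p572037) carries the hypothesis `P ≤ P₀`.  In the
whole chain that hypothesis is consumed in exactly two ways: (a) through `Kelvin.norm_flow_le_of_nonpos` — the Bernoulli
function `ℋ` has bounded superlevel sets when `P ≤ P₀`, so backward trajectories are bounded; (b) in the final constant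
kill (`V ≡ b ≠ 0`, `P = −(1−γ)⟪b,·⟩` is a genuine bounded smooth profile).  Observation of this file: **(a) needs no
pressure at all.**  By the lead's outgoing lower bound `e^{γs}(‖y‖ − M/γ) ≤ ‖Φ_s y‖` (`norm_flow_ge`, `s ≥ 0`) applied to
`Φ_s x` with time `−s` and the group law, `‖Φ_s x‖ ≤ ‖x‖ + M/γ` for every `s ≤ 0`: a bounded velocity confines every
backward similarity trajectory to a ball, whatever the pressure does at infinity.

* `norm_flow_le_of_nonpos'` — **`‖Φ_s x‖ ≤ ‖x‖ + M/γ` for `s ≤ 0`** (`0 < γ`, `‖V‖ ≤ M`, `‖DV‖ ≤ K`; no profile equation,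
  no pressure);
* the pressure-free twins (primed names, proofs verbatim from the `Kelvin` files with the new confinement radius) of
  `tendsto_transport_flow_atBot`, `exists_mem_nodalSet_mapClusterPt_atBot`, `nodalSet_nonempty`,
  `mem_nodalSet_of_mapClusterPt_atBot`, `exists_tendsto_flow_atBot_of_finite`, `exists_forall_le_mem_of_mapClusterPt_subset`,
  `integrableOn_norm_transport_sq_backward`, `tendsto_driftCoordinate_flow_atBot`, `tendsto_flow_atBot_of_driftCoordinate`
  — every statement of `…SelfSimilarAlphaLimit` / `…FiniteHyperbolic` (unconditional part) / `…BackwardDrift` that took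
  `(hP : ∀ y, P y ≤ P₀)` now holds WITHOUT it.

Sequel files re-run the no-drift theorem, the bad-node analysis and the endgame on this kit: the classical stratum closes
with NO pressure clause at member level (the class's own `A`-gauge kills the constants).  WHAT THIS IS NOT: not NS, not E,
not rung C1 — backward-trajectory lemmas for bounded classical profiles.  [folklore; ConstantinIgnatovaVicol2026Putative
§3.4.1 (3.21), §3.4.3 (3.31)–(3.33) (setting; the confinement there uses `ℋ`)]
-/

noncomputable section

-- flat `Theorems/<Route><Decl>…` files of one crux share the namespace of the crux (tree convention)
set_option linter.dupNamespace false

open MeasureTheory Set Filter Topology Metric Function InnerProductSpace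
open scoped RealInnerProductSpace NNReal ContDiff

namespace Summit.NavierStokesRegularity.NavierStokesRegularity.Theorems.PowerGaugeEulerLiouville.Kelvin

open Literature.Analysis Literature.Analysis.FluidPDE Literature.Dynamics.FixedPoints
  Literature.Dynamics.TopologicalDynamics

variable {γ : ℝ} {V : EuclideanSpace ℝ (Fin 3) → EuclideanSpace ℝ (Fin 3)} {P : EuclideanSpace ℝ (Fin 3) → ℝ}

/-! ### Backward confinement from a bounded velocity alone -/

/-- **Backward similarity trajectories of a bounded profile are bounded — no pressure, no profile equation**:
`‖Φ_s x‖ ≤ ‖x‖ + M/γ` for `s ≤ 0` when `‖V‖ ≤ M`, `‖DV‖ ≤ K`, `0 < γ`.  (Outgoing lower bound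
`e^{−γs}(‖Φ_s x‖ − M/γ) ≤ ‖Φ_{−s}(Φ_s x)‖ = ‖x‖` and `e^{−γs} ≥ 1`.)  Pressure-free replacement of
`norm_flow_le_of_nonpos`. [folklore] -/
theorem norm_flow_le_of_nonpos' (hV : ContDiff ℝ ∞ V) {K : ℝ} (hK : ∀ y, ‖fderiv ℝ V y‖ ≤ K)
    {M : ℝ} (hM : ∀ y, ‖V y‖ ≤ M) (hγ : 0 < γ) (x : EuclideanSpace ℝ (Fin 3)) {s : ℝ} (hs : s ≤ 0) :
    ‖ODE.evolutionMap (fun _ : ℝ => selfSimilarTransport γ 0 V) 0 s x‖ ≤ ‖x‖ + M / γ := by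
  set z := ODE.evolutionMap (fun _ : ℝ => selfSimilarTransport γ 0 V) 0 s x with hz
  have hM0 : 0 ≤ M := (norm_nonneg _).trans (hM 0)
  -- `Φ_{−s} z = x` (group law)
  have hback : ODE.evolutionMap (fun _ : ℝ => selfSimilarTransport γ 0 V) 0 (-s) z = x := by
    rw [hz, ← flow_add hV hK (-s) s x, neg_add_cancel, flow_zero]
  have h := norm_flow_ge (γ := γ) hV hK hM hγ (neg_nonneg.2 hs) z
  rw [hback] at h
  have hexp : 1 ≤ Real.exp (γ * (-s)) := Real.one_le_exp (mul_nonneg hγ.le (neg_nonneg.2 hs))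
  by_cases hle : ‖z‖ - M / γ ≤ 0
  · linarith [norm_nonneg x, div_nonneg hM0 hγ.le]
  · push Not at hle
    have h2 : ‖z‖ - M / γ ≤ Real.exp (γ * (-s)) * (‖z‖ - M / γ) := le_mul_of_one_le_left hle.le hexp
    linarith

/-! ### The pressure-free backward-trajectory kit -/

/-- **Every point of space flows backward into rest — no pressure hypothesis** (`0 < γ < ½`, `‖V‖ ≤ M`, `‖DV‖ ≤ K`): `W(Φ_s y) → 0` as `s → −∞`, for
every `y`. [cite: ConstantinIgnatovaVicol2026Putative, §3.4.3 eq. (3.31)–(3.33), Rem. 3.6] -/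
theorem tendsto_transport_flow_atBot' (hV : ContDiff ℝ ∞ V) {K : ℝ} (hK : ∀ y, ‖fderiv ℝ V y‖ ≤ K)
    (hprof : IsSelfSimilarEulerProfile γ 0 V P) {M : ℝ} (hM : ∀ y, ‖V y‖ ≤ M)
    (hγ : 0 < γ) (hγ2 : γ < 1 / 2) (y : EuclideanSpace ℝ (Fin 3)) :
    Tendsto (fun s => selfSimilarTransport γ 0 V
      (ODE.evolutionMap (fun _ : ℝ => selfSimilarTransport γ 0 V) 0 s y)) atBot (𝓝 0) := by
  have hY := hasDerivAt_flow_neg (γ := γ) hV hK y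
  have hB : ∀ t : ℝ, 0 ≤ t → ‖ODE.evolutionMap (fun _ : ℝ => selfSimilarTransport γ 0 V) 0 (-t) y‖ ≤ ‖y‖ + M / γ :=
    fun t ht => norm_flow_le_of_nonpos' hV hK hM hγ y (by linarith)
  have hlim := hprof.tendsto_transport_comp_of_bounded (ne_of_lt hγ2) (σ := -1) (by norm_num) hY hB
  have hcomp := hlim.comp tendsto_neg_atBot_atTop
  refine hcomp.congr fun s => ?_
  simp only [Function.comp_apply, neg_neg]

/-- **Every backward trajectory accumulates at a stagnation point — no pressure hypothesis** (`0 < γ < ½`): for every `y` there is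
`z` in the nodal set `𝒩_W` (`W(z) = 0`) which is a cluster point of `Φ_{−t} y` as `t → ∞`; in particular the
stagnation set of an in-window classical profile with bounded `V`, `DV` (and NO condition on `P`) is non-empty and
its unstable set is all of `ℝ³`. [cite: ConstantinIgnatovaVicol2026Putative, §3.4.3 eq. (3.33), Rem. 3.6] -/
theorem exists_mem_nodalSet_mapClusterPt_atBot' (hV : ContDiff ℝ ∞ V) {K : ℝ} (hK : ∀ y, ‖fderiv ℝ V y‖ ≤ K)
    (hprof : IsSelfSimilarEulerProfile γ 0 V P) {M : ℝ} (hM : ∀ y, ‖V y‖ ≤ M)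
    (hγ : 0 < γ) (hγ2 : γ < 1 / 2) (y : EuclideanSpace ℝ (Fin 3)) :
    ∃ z ∈ selfSimilarNodalSet γ 0 V,
      MapClusterPt z atTop (fun t => ODE.evolutionMap (fun _ : ℝ => selfSimilarTransport γ 0 V) 0 (-t) y) := by
  have hY := hasDerivAt_flow_neg (γ := γ) hV hK y
  have hB : ∀ t : ℝ, 0 ≤ t → ‖ODE.evolutionMap (fun _ : ℝ => selfSimilarTransport γ 0 V) 0 (-t) y‖ ≤ ‖y‖ + M / γ :=
    fun t ht => norm_flow_le_of_nonpos' hV hK hM hγ y (by linarith)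
  obtain ⟨z, hz, -, hcl⟩ :=
    hprof.exists_mem_nodalSet_mapClusterPt_of_bounded (ne_of_lt hγ2) (σ := -1) (by norm_num) hY hB
  exact ⟨z, hz, hcl⟩

/-- In particular **the stagnation set of an in-window classical profile with `V`, `DV` bounded is non-empty** — no
pressure hypothesis (pressure-free form of `nodalSet_nonempty`).
[cite: ConstantinIgnatovaVicol2026Putative, §3.5 Def. 3.7 (the nodal set), Rem. 3.6] -/
theorem nodalSet_nonempty' (hV : ContDiff ℝ ∞ V) {K : ℝ} (hK : ∀ y, ‖fderiv ℝ V y‖ ≤ K)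
    (hprof : IsSelfSimilarEulerProfile γ 0 V P) {M : ℝ} (hM : ∀ y, ‖V y‖ ≤ M)
    (hγ : 0 < γ) (hγ2 : γ < 1 / 2) : (selfSimilarNodalSet γ 0 V).Nonempty := by
  obtain ⟨z, hz, -⟩ := exists_mem_nodalSet_mapClusterPt_atBot' hV hK hprof hM hγ hγ2 0
  exact ⟨z, hz⟩


/-- **Every backward limit point is a stagnation point — no pressure hypothesis** (`0 < γ < ½`): if `z` is a cluster point of `Φ_s y`
as `s → −∞` then `W(z) = 0`, because `W(Φ_s y) → 0` (`tendsto_transport_flow_atBot'`) and `W` is continuous.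
[cite: ConstantinIgnatovaVicol2026Putative, §3.4.3 eq. (3.33)] -/
theorem mem_nodalSet_of_mapClusterPt_atBot' (hV : ContDiff ℝ ∞ V) {K : ℝ} (hK : ∀ y, ‖fderiv ℝ V y‖ ≤ K)
    (hprof : IsSelfSimilarEulerProfile γ 0 V P) {M : ℝ} (hM : ∀ y, ‖V y‖ ≤ M)
    (hγ : 0 < γ) (hγ2 : γ < 1 / 2) {y z : EuclideanSpace ℝ (Fin 3)}
    (hz : MapClusterPt z atBot fun s => ODE.evolutionMap (fun _ : ℝ => selfSimilarTransport γ 0 V) 0 s y) :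
    z ∈ selfSimilarNodalSet γ 0 V := by
  have hWc : Continuous (selfSimilarTransport γ 0 V) :=
    (contDiff_selfSimilarTransport (γ := γ) hV).continuous
  have h1 : MapClusterPt (selfSimilarTransport γ 0 V z) atBot
      (selfSimilarTransport γ 0 V ∘ fun s => ODE.evolutionMap (fun _ : ℝ => selfSimilarTransport γ 0 V) 0 s y) :=
    hz.continuousAt_comp hWc.continuousAt
  have h2 := tendsto_transport_flow_atBot' hV hK hprof hM hγ hγ2 y
  have h3 : ClusterPt (selfSimilarTransport γ 0 V z) (𝓝 0) := h1.clusterPt.mono h2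
  exact eq_of_nhds_neBot h3

/-- **Finitely many stagnation points ⇒ every backward trajectory converges to one of them — no pressure
hypothesis** (`0 < γ < ½`): backward trajectories are bounded (`norm_flow_le_of_nonpos'`), their limit points are stagnation points, and the
α-limit set of a bounded backward semi-orbit is connected (Robinson Ch. V Thm 4.1 (d)), hence a single point of
the finite set `𝒩_W`. [cite: Robinson1999, Ch. V Thm 4.1 (d)] -/
theorem exists_tendsto_flow_atBot_of_finite' (hV : ContDiff ℝ ∞ V) {K : ℝ} (hK : ∀ y, ‖fderiv ℝ V y‖ ≤ K)
    (hprof : IsSelfSimilarEulerProfile γ 0 V P) {M : ℝ} (hM : ∀ y, ‖V y‖ ≤ M)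
    (hγ : 0 < γ) (hγ2 : γ < 1 / 2) (hfin : (selfSimilarNodalSet γ 0 V).Finite)
    (y : EuclideanSpace ℝ (Fin 3)) :
    ∃ z ∈ selfSimilarNodalSet γ 0 V,
      Tendsto (fun s => ODE.evolutionMap (fun _ : ℝ => selfSimilarTransport γ 0 V) 0 s y) atBot (𝓝 z) := by
  set B : ℝ := ‖y‖ + M / γ with hB
  have hK' : IsCompact (closedBall (0 : EuclideanSpace ℝ (Fin 3)) B) := isCompact_closedBall 0 B
  have htail : ∀ᶠ s in atBot,
      ODE.evolutionMap (fun _ : ℝ => selfSimilarTransport γ 0 V) 0 s y ∈ closedBall (0 : EuclideanSpace ℝ (Fin 3)) B := by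
    filter_upwards [eventually_le_atBot (0 : ℝ)] with s hs
    rw [mem_closedBall, dist_zero_right, hB]
    exact norm_flow_le_of_nonpos' hV hK hM hγ y hs
  exact exists_tendsto_atBot_of_mapClusterPt_mem_finite (continuous_flow_apply (γ := γ) hV hK y) hK' htail hfin
    fun z hz => mem_nodalSet_of_mapClusterPt_atBot' hV hK hprof hM hγ hγ2 hz


/-- **If every backward cluster point lies in the open set `U`, the backward trajectory is eventually in `U`** —
no pressure hypothesis, no profile equation (`0 < γ`, `‖V‖ ≤ M`: backward trajectories are bounded, so outside `U` they would accumulate in the compact set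
`B̄(0, B) ∖ U`). [folklore] -/
theorem exists_forall_le_mem_of_mapClusterPt_subset' (hV : ContDiff ℝ ∞ V) {K : ℝ} (hK : ∀ y, ‖fderiv ℝ V y‖ ≤ K)
    {M : ℝ} (hM : ∀ y, ‖V y‖ ≤ M) (hγ : 0 < γ) (x : EuclideanSpace ℝ (Fin 3)) {U : Set (EuclideanSpace ℝ (Fin 3))}
    (hU : IsOpen U)
    (hclU : ∀ z, MapClusterPt z atBot (fun s => ODE.evolutionMap (fun _ : ℝ => selfSimilarTransport γ 0 V) 0 s x) →
      z ∈ U) :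
    ∃ S : ℝ, ∀ s ≤ S, ODE.evolutionMap (fun _ : ℝ => selfSimilarTransport γ 0 V) 0 s x ∈ U := by
  set Φ := ODE.evolutionMap (fun _ : ℝ => selfSimilarTransport γ 0 V) 0 with hΦ
  set B : ℝ := ‖x‖ + M / γ with hB
  have hKc : IsCompact (closedBall (0 : EuclideanSpace ℝ (Fin 3)) B \ U) := (isCompact_closedBall 0 B).diff hU
  have htail : ∀ᶠ s in atBot, Φ s x ∈ closedBall (0 : EuclideanSpace ℝ (Fin 3)) B := by
    filter_upwards [eventually_le_atBot (0 : ℝ)] with s hs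
    rw [mem_closedBall, dist_zero_right, hB]
    exact norm_flow_le_of_nonpos' hV hK hM hγ x hs
  have hev : ∀ᶠ s in atBot, Φ s x ∈ U := by
    by_contra hnot
    have hfreq : ∃ᶠ s in atBot, Φ s x ∈ closedBall (0 : EuclideanSpace ℝ (Fin 3)) B \ U := by
      have h1 : ∃ᶠ s in atBot, Φ s x ∉ U := not_eventually.1 hnot
      exact (h1.and_eventually htail).mono fun s hs => ⟨hs.2, hs.1⟩
    obtain ⟨z, hz, hcl⟩ := hKc.exists_mapClusterPt_of_frequently hfreq
    exact hz.2 (hclU z hcl)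
  obtain ⟨S, hS⟩ := eventually_atBot.1 hev
  exact ⟨S, hS⟩

/-- **`‖W(Φ_{−t} x)‖²` is integrable on `(0, ∞)` — no pressure hypothesis** (`0 < γ < ½`): the Bernoulli function is a bounded strict
Lyapunov function along the bounded backward trajectory (`exists_integral_norm_transport_sq_le`).
[cite: ConstantinIgnatovaVicol2026Putative, §3.4.3 eq. (3.31)] -/
theorem integrableOn_norm_transport_sq_backward' (hV : ContDiff ℝ ∞ V) {K : ℝ} (hK : ∀ y, ‖fderiv ℝ V y‖ ≤ K)
    (hprof : IsSelfSimilarEulerProfile γ 0 V P) {M : ℝ} (hM : ∀ y, ‖V y‖ ≤ M)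
    (hγ : 0 < γ) (hγ2 : γ < 1 / 2) (x : EuclideanSpace ℝ (Fin 3)) :
    IntegrableOn (fun t : ℝ => ‖selfSimilarTransport γ 0 V
      (ODE.evolutionMap (fun _ : ℝ => selfSimilarTransport γ 0 V) 0 (-t) x)‖ ^ 2) (Ioi 0) := by
  have hY := hasDerivAt_flow_neg (γ := γ) hV hK x
  have hBd : ∀ t : ℝ, 0 ≤ t → ‖ODE.evolutionMap (fun _ : ℝ => selfSimilarTransport γ 0 V) 0 (-t) x‖ ≤ ‖x‖ + M / γ :=
    fun t ht => norm_flow_le_of_nonpos' hV hK hM hγ x (by linarith)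
  obtain ⟨C, hC⟩ := hprof.exists_integral_norm_transport_sq_le (ne_of_lt hγ2) (σ := -1) (by norm_num) hY hBd
  have hcont : Continuous fun t : ℝ => ‖selfSimilarTransport γ 0 V
      (ODE.evolutionMap (fun _ : ℝ => selfSimilarTransport γ 0 V) 0 (-t) x)‖ ^ 2 :=
    (((contDiff_selfSimilarTransport (γ := γ) hV).continuous.comp
      ((continuous_flow_apply (γ := γ) hV hK x).comp continuous_neg)).norm).pow 2
  refine integrableOn_Ioi_of_intervalIntegral_norm_bounded C 0 (l := atTop) (b := fun n : ℕ => (n : ℝ))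
    (fun n => (hcont.integrableOn_Icc).mono_set Ioc_subset_Icc_self) tendsto_natCast_atTop_atTop ?_
  refine Eventually.of_forall fun n => ?_
  have h := hC 0 n le_rfl (Nat.cast_nonneg n)
  refine le_trans (le_of_eq ?_) h
  refine intervalIntegral.integral_congr fun t _ => ?_
  simp only [Real.norm_eq_abs, abs_pow, abs_norm]

/-- **A drift coordinate converges along the backward trajectory — no pressure hypothesis.**  Let `f` be `C¹` with
`‖Df(y) W(y)‖ ≤ C‖W(y)‖²` on an open set `U` containing every backward cluster point of `x`.  Then `f(Φ_s x)`
converges as `s → −∞` (its speed is integrable: `∫‖W‖² < ∞`). [folklore; cf. Aulbach1984 Thm 2.3] -/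
theorem tendsto_driftCoordinate_flow_atBot' (hV : ContDiff ℝ ∞ V) {K : ℝ} (hK : ∀ y, ‖fderiv ℝ V y‖ ≤ K)
    (hprof : IsSelfSimilarEulerProfile γ 0 V P) {M : ℝ} (hM : ∀ y, ‖V y‖ ≤ M)
    (hγ : 0 < γ) (hγ2 : γ < 1 / 2) (x : EuclideanSpace ℝ (Fin 3)) {U : Set (EuclideanSpace ℝ (Fin 3))}
    (hU : IsOpen U)
    (hclU : ∀ z, MapClusterPt z atBot (fun s => ODE.evolutionMap (fun _ : ℝ => selfSimilarTransport γ 0 V) 0 s x) →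
      z ∈ U)
    {F' : Type*} [NormedAddCommGroup F'] [NormedSpace ℝ F'] [CompleteSpace F']
    {f : EuclideanSpace ℝ (Fin 3) → F'} (hf : ContDiff ℝ 1 f) {C : ℝ}
    (hdrift : ∀ y ∈ U, ‖fderiv ℝ f y (selfSimilarTransport γ 0 V y)‖ ≤ C * ‖selfSimilarTransport γ 0 V y‖ ^ 2) :
    ∃ ℓ : F', Tendsto (fun s => f (ODE.evolutionMap (fun _ : ℝ => selfSimilarTransport γ 0 V) 0 s x))
      atBot (𝓝 ℓ) := by
  set Φ := ODE.evolutionMap (fun _ : ℝ => selfSimilarTransport γ 0 V) 0 with hΦ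
  obtain ⟨S, hS⟩ := exists_forall_le_mem_of_mapClusterPt_subset' hV hK hM hγ x hU hclU
  -- work in the backward time `t = −s ≥ T₀ := max (−S) 0`
  set T₀ : ℝ := max (-S) 0 with hT₀
  set G : ℝ → F' := fun t => f (Φ (-t) x) with hG
  set G' : ℝ → F' := fun t => -(fderiv ℝ f (Φ (-t) x) (selfSimilarTransport γ 0 V (Φ (-t) x))) with hG'
  have hGd : ∀ t, HasDerivAt G (G' t) t := by
    intro t
    have h := ((hf.differentiable one_ne_zero) _).hasFDerivAt.comp_hasDerivAt t
      (hasDerivAt_flow_neg (γ := γ) hV hK x t)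
    have e : fderiv ℝ f (Φ (-t) x) ((-1 : ℝ) • selfSimilarTransport γ 0 V (Φ (-t) x)) = G' t := by
      rw [hG', map_smul, neg_one_smul]
    exact h.congr_deriv e
  have hWc : Continuous fun t => selfSimilarTransport γ 0 V (Φ (-t) x) :=
    (contDiff_selfSimilarTransport (γ := γ) hV).continuous.comp
      ((continuous_flow_apply (γ := γ) hV hK x).comp continuous_neg)
  have hG'c : Continuous G' := by
    have h1 : Continuous fun t => fderiv ℝ f (Φ (-t) x) :=
      (hf.continuous_fderiv one_ne_zero).comp ((continuous_flow_apply (γ := γ) hV hK x).comp continuous_neg)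
    exact (h1.clm_apply hWc).neg
  -- `‖G' t‖ ≤ C ‖W(Φ_{−t} x)‖²` for `t ≥ T₀`
  have hG'le : ∀ t, T₀ ≤ t → ‖G' t‖ ≤ C * ‖selfSimilarTransport γ 0 V (Φ (-t) x)‖ ^ 2 := by
    intro t ht
    have hmem : Φ (-t) x ∈ U := hS _ (by rw [hT₀] at ht; linarith [le_max_left (-S) 0])
    have h := hdrift _ hmem
    simp only [hG', norm_neg]
    exact h
  -- `G'` is integrable on `(T₀, ∞)`
  have hω := integrableOn_norm_transport_sq_backward' hV hK hprof hM hγ hγ2 x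
  have hG'int : IntegrableOn G' (Ioi T₀) := by
    have hωT : IntegrableOn (fun t : ℝ => C * ‖selfSimilarTransport γ 0 V (Φ (-t) x)‖ ^ 2) (Ioi T₀) :=
      (hω.mono_set (Ioi_subset_Ioi (le_max_right _ _))).const_mul C
    refine Integrable.mono' hωT hG'c.aestronglyMeasurable ?_
    refine (ae_restrict_mem measurableSet_Ioi).mono fun t ht => hG'le t (le_of_lt ht)
  -- FTC: `G t = G T₀ + ∫_{T₀}^t G'`, and the integral converges
  have hFTC : ∀ t, G t = G T₀ + ∫ τ in T₀..t, G' τ := by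
    intro t
    have h := intervalIntegral.integral_eq_sub_of_hasDerivAt (fun τ _ => hGd τ) (hG'c.intervalIntegrable T₀ t)
    rw [h]; abel
  have hlim : Tendsto (fun t => ∫ τ in T₀..t, G' τ) atTop (𝓝 (∫ τ in Ioi T₀, G' τ)) :=
    intervalIntegral_tendsto_integral_Ioi T₀ hG'int tendsto_id
  refine ⟨G T₀ + ∫ τ in Ioi T₀, G' τ, ?_⟩
  have hGlim : Tendsto G atTop (𝓝 (G T₀ + ∫ τ in Ioi T₀, G' τ)) := by
    have h := hlim.const_add (G T₀)
    exact h.congr fun t => (hFTC t).symm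
  have h := hGlim.comp tendsto_neg_atBot_atTop
  refine h.congr fun s => ?_
  simp only [hG, Function.comp_apply, neg_neg]

/-- **SINGLE-POINT CONVERGENCE FROM A DRIFT COORDINATE — no pressure hypothesis.**  Let `(V, P)` be a classical
in-window profile (`0 < γ < ½`, `V` smooth bounded, `‖DV‖ ≤ K`; NO condition on `P`) and `x` any point.  Suppose an open set `U`
contains every backward cluster point of `x` and carries a `C¹` map `f` (values in a complete normed space) with
`‖Df(y) W(y)‖ ≤ C‖W(y)‖²` on `U` which is INJECTIVE on `𝒩_W ∩ U`.  Then the backward trajectory of `x` converges to a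
single stagnation point.  (All cluster points are stagnation points in `U` with the common value `lim f(Φ_s x)`.)
[folklore; cf. Aulbach1984 Thm 2.3 (convergence to one equilibrium near a normally hyperbolic manifold of equilibria)] -/
theorem tendsto_flow_atBot_of_driftCoordinate' (hV : ContDiff ℝ ∞ V) {K : ℝ} (hK : ∀ y, ‖fderiv ℝ V y‖ ≤ K)
    (hprof : IsSelfSimilarEulerProfile γ 0 V P) {M : ℝ} (hM : ∀ y, ‖V y‖ ≤ M)
    (hγ : 0 < γ) (hγ2 : γ < 1 / 2) (x : EuclideanSpace ℝ (Fin 3)) {U : Set (EuclideanSpace ℝ (Fin 3))}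
    (hU : IsOpen U)
    (hclU : ∀ z, MapClusterPt z atBot (fun s => ODE.evolutionMap (fun _ : ℝ => selfSimilarTransport γ 0 V) 0 s x) →
      z ∈ U)
    {F' : Type*} [NormedAddCommGroup F'] [NormedSpace ℝ F'] [CompleteSpace F']
    {f : EuclideanSpace ℝ (Fin 3) → F'} (hf : ContDiff ℝ 1 f) {C : ℝ}
    (hdrift : ∀ y ∈ U, ‖fderiv ℝ f y (selfSimilarTransport γ 0 V y)‖ ≤ C * ‖selfSimilarTransport γ 0 V y‖ ^ 2)
    (hinj : InjOn f (selfSimilarNodalSet γ 0 V ∩ U)) :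
    ∃ z ∈ selfSimilarNodalSet γ 0 V,
      Tendsto (fun s => ODE.evolutionMap (fun _ : ℝ => selfSimilarTransport γ 0 V) 0 s x) atBot (𝓝 z) := by
  set Φ := ODE.evolutionMap (fun _ : ℝ => selfSimilarTransport γ 0 V) 0 with hΦ
  obtain ⟨ℓ, hℓ⟩ := tendsto_driftCoordinate_flow_atBot' hV hK hprof hM hγ hγ2 x hU hclU hf hdrift
  -- every cluster point has `f`-value `ℓ`
  have hval : ∀ z, MapClusterPt z atBot (fun s => Φ s x) → f z = ℓ := by
    intro z hz
    have h1 : MapClusterPt (f z) atBot (f ∘ fun s => Φ s x) := hz.continuousAt_comp hf.continuous.continuousAt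
    exact eq_of_nhds_neBot (h1.clusterPt.mono hℓ)
  -- the tail lies in a compact ball; a cluster point exists
  set B : ℝ := ‖x‖ + M / γ with hB
  have hKc : IsCompact (closedBall (0 : EuclideanSpace ℝ (Fin 3)) B) := isCompact_closedBall 0 B
  have htail : ∀ᶠ s in atBot, Φ s x ∈ closedBall (0 : EuclideanSpace ℝ (Fin 3)) B := by
    filter_upwards [eventually_le_atBot (0 : ℝ)] with s hs
    rw [mem_closedBall, dist_zero_right, hB]
    exact norm_flow_le_of_nonpos' hV hK hM hγ x hs
  obtain ⟨z, -, hz⟩ := hKc.exists_mapClusterPt_of_frequently htail.frequently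
  have hzN : z ∈ selfSimilarNodalSet γ 0 V := mem_nodalSet_of_mapClusterPt_atBot' hV hK hprof hM hγ hγ2 hz
  refine ⟨z, hzN, hKc.tendsto_nhds_of_unique_mapClusterPt htail fun z' _ hz' => ?_⟩
  have hz'N : z' ∈ selfSimilarNodalSet γ 0 V := mem_nodalSet_of_mapClusterPt_atBot' hV hK hprof hM hγ hγ2 hz'
  exact hinj ⟨hz'N, hclU z' hz'⟩ ⟨hzN, hclU z hz⟩ ((hval z' hz').trans (hval z hz).symm)

end Summit.NavierStokesRegularity.NavierStokesRegularity.Theorems.PowerGaugeEulerLiouville.Kelvin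

end
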